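import Literature.NumberTheory.Automorphic.ArchRankinSelbergPairEntireRatio
import Literature.NumberTheory.Automorphic.PairLFunctionNeConjLevelOneOfTestVector
import Literature.NumberTheory.Automorphic.ArchRankinSelbergTestVectorRankOne

/-!
# Crux `PairLBoundaryJS` (stmt-Langlands-13622), line `Sketch`, skeleton v24 — the repaired equal-rank archimedean
# stub is IMPLIED by the old one, and HOLDS in rank one

Summit `Langlands`, sub-problem `Langlands`, helper file under `Theorems/` supporting the crux `PairLBoundaryJS`
(Arthur–Clozel (1989), Ch. 3, (2.2)), line `Sketch`, lead c7. Skeleton v24 replaces the equal-rank archimedean named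
fact `HumphriesJo2024_archRankinSelberg_testVector n K` (Humphries–Jo (2024): ONE explicit `K_∞`-finite test vector
with `Ψ_∞ = c^s ∏ Γ_ℝ(s + a_j) ∏ Γ_ℂ(s + b_j)` exactly) by the POINTWISE entire-ratio control
`JacquetShalika1990_archRankinSelbergPair_entireRatio n K` (`ArchRankinSelbergPairEntireRatio`, p166303: for every `s₀`
finitely many `K_∞`-finite Gårding data with real non-negative Schwartz test functions and entire `Λ`, `h`,
`h(s₀) ≠ 0`, `Λ · Σ Ψ_∞ = h` on `re s > 1`; Jacquet (2009) Thm. 2.1/2.3/2.6 (ii)/2.7 (ii), Jacquet–Shalika (1990) §5)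
— the `(n, n, Φ)` sibling of the gap stub `JacquetShalika1990_archRankinSelbergGap_entireRatio`. This file records that
the repair is MONOTONE and consistent:

* `archPairEntireRatio_of_testVector` — `HumphriesJo2024_archRankinSelberg_testVector n K →
  JacquetShalika1990_archRankinSelbergPair_entireRatio n K` (the landed splitting `archPairLFactorData_of_testVector`
  gives the data with `Λ Σ Ψ_∞ = 1`; take `h = 1` for every `s₀`);
* `stub_archPairEntireRatio_one` — the new fact HOLDS in rank `n = 1` over every number field (Tate's computation,
  `HumphriesJo2024_archRankinSelberg_testVector_one`).

## References

* H. Jacquet, *Archimedean Rankin–Selberg integrals*, Contemp. Math. 489 (2009), Thm. 2.1, 2.3, 2.6 (ii), 2.7 (ii)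
  [JacquetArchimedeanRS2009].
* P. Humphries, Y. Jo, *Test vectors for archimedean period integrals*, Publ. Mat. 68 (2024), Thm. 1.1, Thm. 5.6
  [HumphriesJo2024].
* J. Tate, *Fourier analysis in number fields and Hecke's zeta-functions* (1967), §2.5 [TateThesis1967].
-/

noncomputable section

-- `Summit.Langlands.Langlands.…` (summit = sub-problem name, D-0017 layout) trips `dupNamespace`
set_option linter.dupNamespace false

open Literature.NumberTheory.Automorphic

namespace Summit.Langlands.Langlands.Theorems.PairLBoundaryJSArchEntireRatioOfTestVector

/-- **HJ ⇒ the repaired equal-rank stub**: `HumphriesJo2024_archRankinSelberg_testVector n K` implies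
`JacquetShalika1990_archRankinSelbergPair_entireRatio n K` — the landed splitting `archPairLFactorData_of_testVector`
turns Humphries–Jo's single test vector into finitely many `K_∞`-finite data with non-negative Schwartz test functions
and an entire `Λ = c^{-s} ∏ Γ_ℝ⁻¹ ∏ Γ_ℂ⁻¹` with `Λ Σ Ψ_∞ = 1` on `re s > 1`; take `h = 1` at every `s₀`.
[cite: HumphriesJo2024, Thm. 1.1 and Thm. 5.6] [cite: JacquetArchimedeanRS2009, Thm. 2.7 (ii) (p. 10)] -/
theorem archPairEntireRatio_of_testVector {n : ℕ} {K : Type} [Field K] [NumberField K]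
    (hHJ : HumphriesJo2024_archRankinSelberg_testVector n K) :
    JacquetShalika1990_archRankinSelbergPair_entireRatio n K := by
  intro hcpt E _ _ _ τ hτ hτu hτi ℓ hℓ hℓ0 E' _ _ _ τ' hτ' hτu' hτi' ℓ' hℓ' hℓ'0 _ _ _ _ μA hμA μK hμK s₀
  obtain ⟨m, e, e', hfin, hfin', Φinf, hΦc, hΦ0, hΦS, Λ, hΛ, hsum⟩ :=
    archPairLFactorData_of_testVector hHJ hcpt E τ hτ hτu hτi ℓ hℓ hℓ0 E' τ' hτ' hτu' hτi' ℓ' hℓ' hℓ'0 μA hμA μK hμK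
  exact ⟨m, e, e', hfin, hfin', Φinf, hΦc, hΦ0, hΦS, Λ, fun _ => 1, hΛ, differentiable_const _, one_ne_zero, hsum⟩

/-- **All ranks at once**: the universally closed Humphries–Jo fact implies the universally closed repaired stub
(the shape in which the skeleton consumes it). [cite: HumphriesJo2024, Thm. 1.1] -/
theorem stub_archPairEntireRatio_of_testVector :
    (∀ (N : ℕ) (K : Type) [Field K] [NumberField K], HumphriesJo2024_archRankinSelberg_testVector N K) → ∀ (N : ℕ) (K : Type) [Field K] [NumberField K], JacquetShalika1990_archRankinSelbergPair_entireRatio N K :=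
  fun hHJ N K _ _ => archPairEntireRatio_of_testVector (hHJ N K)

/-- **The repaired stub HOLDS in rank one** (every number field): from the landed rank-one case of Humphries–Jo's
theorem (`HumphriesJo2024_archRankinSelberg_testVector_one`: `GL_1(K_∞)` acts by a unitary character, Tate's
polynomial-times-Gaussian local zeta integrals). [cite: TateThesis1967, §2.5 (pp. 343–345)]
[cite: HumphriesJo2024, Thm. 1.1 (the case n = 1)] -/
theorem stub_archPairEntireRatio_one :
    ∀ (K : Type) [Field K] [NumberField K], JacquetShalika1990_archRankinSelbergPair_entireRatio 1 K :=
  fun K _ _ => archPairEntireRatio_of_testVector (HumphriesJo2024_archRankinSelberg_testVector_one (K := K))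

end Summit.Langlands.Langlands.Theorems.PairLBoundaryJSArchEntireRatioOfTestVector

end
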